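import Summits.HubbardSuperconductivity.HubbardSuperconductivity.Theorems.CooperPairDMottWalkBindingWalkShibaTransport

/-!
# Route `CooperPairDMottWalk`, crux `BindingWalk` (stmt-HubbardSuperconductivity-1176):
# the Shiba dictionary for spin-sector energies; two-hole binding in attractive language

Helper file (`--supports stmt-HubbardSuperconductivity-1176`), continuation of
`CooperPairDMottWalkBindingWalkShibaTransport` (the Shiba unitary `S = orbitalPhase g ·
partialParticleHole D↓`, its action on the spin sectors and the operator identity
`S H(t,U) Sᴴ = H(t,-U) + U N↑`). Here:

* `minEnergyOn_szSector_shiba` — the **sector-energy dictionary** on any finite graph with a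
  bipartite down-spin gauge: `E_{t,U}(a, b) = E_{t,-U}(a, |Λ| - b) + U a` for `a, b ≤ |Λ|`
  (`E_{t,U}(a, b) = minEnergyOn (hamiltonian G t U) (szSector (a+b) ((a-b)/2))`), proved by
  testing each Hamiltonian on the image of the other's sector ground state
  (`upDownSector_groundState`); the `(N↑, N↓)`-resolved form of Lieb–Wu's particle–hole relation
  (Physica A 321 (2003) 1, eq. (3));
* `minEnergyOn_szSector_hubbardTorus_shiba` — the same on the torus `(ℤ/Lℤ)^d`, `L` even
  (gauge = `torusStagger` on the down orbitals);
* `twoHoleBinding_eq_attractive` — on `(ℤ/Lℤ)²`, `L` even: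
  `2E_U(L²-1, ½) - E_U(L², 0) - E_U(L²-2, 0) = 2E_{-U}(L²+1, -½) + U - E_{-U}(L², 0) - E_{-U}(L², -1)`:
  the two-hole pair-binding energy of the REPULSIVE torus is (charge gap) − (spin gap) data of the
  ATTRACTIVE torus at half filling (Lieb-unique singlet ground state, spin-reflection positive —
  the setting of Lieb 1989 Thm 1 and of Tian's gap inequalities, J. Stat. Phys. 116 (2004) 629 §4);
* `twoHoleBinding_iff_attractive`, `pureBinding_iff_attractive` — clause (a) of the route's target
  `PureCooperPair` (= the conclusion of the junction stub `stub_junctionLeg` of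
  `Cruxes/BindingWalk/Lines/birth.lean` at the pure point) is EQUIVALENT, side by side in
  `L = 4k+4`, to the attractive-model inequality
  `E_{-U}(L², -1) + E_{-U}(L², 0) + ε ≤ 2E_{-U}(L²+1, -½) + U`.

This is a reformulation of the stub's conclusion in the language where reflection positivity
lives; it proves neither the stub nor the crux. References: E. H. Lieb, PRL 62 (1989) 1201,
proof of Theorem 2; H. Shiba, Prog. Theor. Phys. 48 (1972) 2171, §2; E. H. Lieb, F. Y. Wu,
Physica A 321 (2003) 1, eq. (3); G.-S. Tian, J. Stat. Phys. 116 (2004) 629, §4. No definition and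
no named fact is introduced.
-/

set_option linter.dupNamespace false

noncomputable section

namespace Summit.HubbardSuperconductivity.HubbardSuperconductivity.Theorems.CooperPairDMottWalk

open Matrix Finset Literature.MathematicalPhysics.QuantumLattice
open scoped symmDiff ComplexOrder

/-! ### The sector-energy dictionary `E_{t,U}(a, b) = E_{t,-U}(a, |Λ| - b) + U a` -/

section Energies

variable {Λ : Type*} [LinearOrder Λ] [Fintype Λ] (G : SimpleGraph Λ) [DecidableRel G.Adj]

/-- `Sᴴ S = 1` for the Shiba unitary. [folklore] -/
theorem shiba_conjTranspose_mul_self {g : Orb Λ → ℂ} (hg : ∀ i, ‖g i‖ = 1) :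
    (orbitalPhase g * partialParticleHole (spinDownOrbitals : Finset (Orb Λ)))ᴴ *
        (orbitalPhase g * partialParticleHole (spinDownOrbitals : Finset (Orb Λ))) = 1 := by
  rw [conjTranspose_mul, Matrix.mul_assoc, ← Matrix.mul_assoc (orbitalPhase g)ᴴ,
    conjTranspose_orbitalPhase_mul hg, Matrix.one_mul, partialParticleHole_conjTranspose_mul]

/-- `S Sᴴ = 1` for the Shiba unitary. [folklore] -/
theorem shiba_mul_conjTranspose_self {g : Orb Λ → ℂ} (hg : ∀ i, ‖g i‖ = 1) :
    (orbitalPhase g * partialParticleHole (spinDownOrbitals : Finset (Orb Λ))) *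
        (orbitalPhase g * partialParticleHole (spinDownOrbitals : Finset (Orb Λ)))ᴴ = 1 := by
  rw [conjTranspose_mul, Matrix.mul_assoc, ← Matrix.mul_assoc (partialParticleHole _),
    partialParticleHole_mul_conjTranspose, Matrix.one_mul, orbitalPhase_mul_conjTranspose hg]

/-- `⟨Sψ, (S A Sᴴ)(Sψ)⟩ = ⟨ψ, A ψ⟩` for an isometry `S` (`Sᴴ S = 1`). [folklore] -/
theorem star_mulVec_dotProduct_conj_mulVec {n : Type*} [Fintype n] [DecidableEq n] {S : Matrix n n ℂ}
    (hSS : Sᴴ * S = 1) (A : Matrix n n ℂ) (ψ : n → ℂ) :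
    star (S *ᵥ ψ) ⬝ᵥ (S * A * Sᴴ) *ᵥ (S *ᵥ ψ) = star ψ ⬝ᵥ A *ᵥ ψ := by
  rw [Matrix.star_mulVec_dotProduct_mulVec]
  congr 2
  rw [Matrix.mul_assoc, Matrix.mul_assoc, hSS, Matrix.mul_one, ← Matrix.mul_assoc, hSS, Matrix.one_mul]

/-- **Energy transfer under `S`**: for `χ` in the sector `(a, b)`,
`Re ⟨Sχ, H(t,-U) Sχ⟩ = Re ⟨χ, H(t,U) χ⟩ - U a Re ⟨χ, χ⟩`. [cite: Lieb1989, proof of Theorem 2] -/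
theorem re_expect_shiba_mulVec {g : Orb Λ → ℂ} (hg : ∀ i, ‖g i‖ = 1) (hg0 : ∀ x, g (orb x 0) = 1)
    (hg1 : ∀ x y, G.Adj x y → g (orb x 1) * star (g (orb y 1)) = -1) (t U : ℝ) {a b : ℕ}
    {χ : Fock (Orb Λ)} (hχ : IsInSector a b χ) :
    (star ((orbitalPhase g * partialParticleHole (spinDownOrbitals : Finset (Orb Λ))) *ᵥ χ) ⬝ᵥ
        hamiltonian G t (-U) *ᵥ
          ((orbitalPhase g * partialParticleHole (spinDownOrbitals : Finset (Orb Λ))) *ᵥ χ)).re =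
      (star χ ⬝ᵥ hamiltonian G t U *ᵥ χ).re - U * a * (star χ ⬝ᵥ χ).re := by
  set S : Matrix (Finset (Orb Λ)) (Finset (Orb Λ)) ℂ :=
    orbitalPhase g * partialParticleHole (spinDownOrbitals : Finset (Orb Λ)) with hS
  have hSS : Sᴴ * S = 1 := shiba_conjTranspose_mul_self hg
  have hconj : S * hamiltonian G t U * Sᴴ = hamiltonian G t (-U) + (U : ℂ) • ∑ x : Λ, numberOp x 0 :=
    shiba_conj_hamiltonian G hg hg0 hg1 t U
  have hatt : hamiltonian G t (-U) = S * hamiltonian G t U * Sᴴ - (U : ℂ) • ∑ x : Λ, numberOp x 0 := by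
    rw [hconj, add_sub_cancel_right]
  have hNup : (∑ x : Λ, numberOp x 0) *ᵥ (S *ᵥ χ) = (a : ℂ) • (S *ᵥ χ) :=
    Summit.HubbardSuperconductivity.TwTipContinuation.IsogapTransport.sum_numberOp_up_mulVec (isInSector_shiba_mulVec g hχ)
  have hnorm : star (S *ᵥ χ) ⬝ᵥ (S *ᵥ χ) = star χ ⬝ᵥ χ :=
    Matrix.star_mulVec_dotProduct_self_of_unitary (fun v => by rw [mulVec_mulVec, hSS, one_mulVec]) χ
  have key : star (S *ᵥ χ) ⬝ᵥ hamiltonian G t (-U) *ᵥ (S *ᵥ χ) =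
      star χ ⬝ᵥ hamiltonian G t U *ᵥ χ - (U : ℂ) * a * (star χ ⬝ᵥ χ) := by
    rw [hatt, sub_mulVec, dotProduct_sub, smul_mulVec, hNup, dotProduct_smul, dotProduct_smul, hnorm,
      star_mulVec_dotProduct_conj_mulVec hSS, smul_eq_mul, smul_eq_mul, ← mul_assoc]
  rw [key, Complex.sub_re]
  congr 1
  have : ((U : ℂ) * a * (star χ ⬝ᵥ χ)).re = U * a * (star χ ⬝ᵥ χ).re := by
    rw [show (U : ℂ) * (a : ℂ) = ((U * a : ℝ) : ℂ) by push_cast; ring, Complex.re_ofReal_mul]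
  exact this

/-- **Energy transfer under `Sᴴ`**: for `φ` in the sector `(a, |Λ| - b)` (`b ≤ |Λ|`),
`Re ⟨Sᴴφ, H(t,U) Sᴴφ⟩ = Re ⟨φ, H(t,-U) φ⟩ + U a Re ⟨φ, φ⟩`. [cite: Lieb1989, proof of Theorem 2] -/
theorem re_expect_shiba_conjTranspose_mulVec {g : Orb Λ → ℂ} (hg : ∀ i, ‖g i‖ = 1)
    (hg0 : ∀ x, g (orb x 0) = 1) (hg1 : ∀ x y, G.Adj x y → g (orb x 1) * star (g (orb y 1)) = -1)
    (t U : ℝ) {a b : ℕ} {φ : Fock (Orb Λ)} (hφ : IsInSector a (Fintype.card Λ - b) φ) :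
    (star ((orbitalPhase g * partialParticleHole (spinDownOrbitals : Finset (Orb Λ)))ᴴ *ᵥ φ) ⬝ᵥ
        hamiltonian G t U *ᵥ
          ((orbitalPhase g * partialParticleHole (spinDownOrbitals : Finset (Orb Λ)))ᴴ *ᵥ φ)).re =
      (star φ ⬝ᵥ hamiltonian G t (-U) *ᵥ φ).re + U * a * (star φ ⬝ᵥ φ).re := by
  set S : Matrix (Finset (Orb Λ)) (Finset (Orb Λ)) ℂ :=
    orbitalPhase g * partialParticleHole (spinDownOrbitals : Finset (Orb Λ)) with hS
  have hconj : S * hamiltonian G t U * Sᴴ = hamiltonian G t (-U) + (U : ℂ) • ∑ x : Λ, numberOp x 0 :=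
    shiba_conj_hamiltonian G hg hg0 hg1 t U
  have hNup : (∑ x : Λ, numberOp x 0) *ᵥ φ = (a : ℂ) • φ :=
    Summit.HubbardSuperconductivity.TwTipContinuation.IsogapTransport.sum_numberOp_up_mulVec hφ
  have key : star (Sᴴ *ᵥ φ) ⬝ᵥ hamiltonian G t U *ᵥ (Sᴴ *ᵥ φ) =
      star φ ⬝ᵥ hamiltonian G t (-U) *ᵥ φ + (U : ℂ) * a * (star φ ⬝ᵥ φ) := by
    rw [Matrix.star_mulVec_dotProduct_mulVec, conjTranspose_conjTranspose, hconj, add_mulVec,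
      dotProduct_add, smul_mulVec, hNup, dotProduct_smul, dotProduct_smul, smul_eq_mul, smul_eq_mul,
      ← mul_assoc]
  rw [key, Complex.add_re]
  congr 1
  rw [show (U : ℂ) * (a : ℂ) = ((U * a : ℝ) : ℂ) by push_cast; ring, Complex.re_ofReal_mul]

/-- **Shiba transport of the spin-sector energies** (the `(N↑, N↓)`-resolved attraction–repulsion
dictionary): on a finite graph whose down-spin orbitals carry a bipartite gauge `g`
(`g = 1` on up orbitals, `g(x↓) g(y↓)* = -1` on bonds), for all `t, U` and `a, b ≤ |Λ|`,
`E_{t,U}(a, b) = E_{t,-U}(a, |Λ| - b) + U a`, where `E_{t,U}(a, b)` is the lowest energy of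
`hamiltonian G t U` in the joint sector `(N, S^z) = (a + b, (a - b)/2)`. Lieb–Wu, Physica A 321
(2003) 1, eq. (3) (spin-resolved); Lieb 1989, proof of Thm 2. [cite: Lieb1989, proof of Theorem 2] -/
theorem minEnergyOn_szSector_shiba {g : Orb Λ → ℂ} (hg : ∀ i, ‖g i‖ = 1) (hg0 : ∀ x, g (orb x 0) = 1)
    (hg1 : ∀ x y, G.Adj x y → g (orb x 1) * star (g (orb y 1)) = -1) (t U : ℝ) {a b : ℕ}
    (ha : a ≤ Fintype.card Λ) (hb : b ≤ Fintype.card Λ) :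
    (hamiltonian G t U).minEnergyOn (szSector (a + b) (((a : ℝ) - b) / 2)) =
      (hamiltonian G t (-U)).minEnergyOn
          (szSector (a + (Fintype.card Λ - b)) (((a : ℝ) - (Fintype.card Λ - b : ℕ)) / 2)) + U * a := by
  set S : Matrix (Finset (Orb Λ)) (Finset (Orb Λ)) ℂ :=
    orbitalPhase g * partialParticleHole (spinDownOrbitals : Finset (Orb Λ)) with hS
  set E₁ := (hamiltonian G t U).minEnergyOn (szSector (a + b) (((a : ℝ) - b) / 2)) with hE₁
  set E₂ := (hamiltonian G t (-U)).minEnergyOn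
    (szSector (a + (Fintype.card Λ - b)) (((a : ℝ) - (Fintype.card Λ - b : ℕ)) / 2)) with hE₂
  have hb' : Fintype.card Λ - b ≤ Fintype.card Λ := Nat.sub_le _ _
  obtain ⟨⟨χ, hχ, hχ0, hHχ⟩, hbd₁⟩ := upDownSector_groundState G t U ha hb
  obtain ⟨⟨χ', hχ', hχ'0, hHχ'⟩, hbd₂⟩ := upDownSector_groundState G t (-U) ha hb'
  have hSS : Sᴴ * S = 1 := shiba_conjTranspose_mul_self hg
  have hSS' : S * Sᴴ = 1 := shiba_mul_conjTranspose_self hg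
  apply le_antisymm
  · -- `E₁ ≤ E₂ + U a`: test `H(t,U)` on `Sᴴ χ'`
    have hψ : IsInSector a b (Sᴴ *ᵥ χ') := isInSector_shiba_conjTranspose_mulVec g hb hχ'
    have h1 := hbd₁ _ hψ
    have hn : star (Sᴴ *ᵥ χ') ⬝ᵥ (Sᴴ *ᵥ χ') = star χ' ⬝ᵥ χ' :=
      Matrix.star_mulVec_dotProduct_self_of_unitary
        (fun v => by rw [conjTranspose_conjTranspose, mulVec_mulVec, hSS', one_mulVec]) χ'
    rw [Literature.MathematicalPhysics.QuantumLattice.expect, re_expect_shiba_conjTranspose_mulVec G hg hg0 hg1 t U hχ', hn] at h1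
    have h2 : (star χ' ⬝ᵥ hamiltonian G t (-U) *ᵥ χ').re = E₂ * (star χ' ⬝ᵥ χ').re := by
      rw [hHχ', dotProduct_smul, smul_eq_mul, Complex.re_ofReal_mul]
    rw [h2] at h1
    have hpos : 0 < (star χ' ⬝ᵥ χ').re := Matrix.star_dotProduct_self_re_pos hχ'0
    nlinarith
  · -- `E₂ + U a ≤ E₁`: test `H(t,-U)` on `S χ`
    have hφ : IsInSector a (Fintype.card Λ - b) (S *ᵥ χ) := isInSector_shiba_mulVec g hχ
    have h1 := hbd₂ _ hφ
    have hn : star (S *ᵥ χ) ⬝ᵥ (S *ᵥ χ) = star χ ⬝ᵥ χ :=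
      Matrix.star_mulVec_dotProduct_self_of_unitary (fun v => by rw [mulVec_mulVec, hSS, one_mulVec]) χ
    rw [Literature.MathematicalPhysics.QuantumLattice.expect, re_expect_shiba_mulVec G hg hg0 hg1 t U hχ, hn] at h1
    have h2 : (star χ ⬝ᵥ hamiltonian G t U *ᵥ χ).re = E₁ * (star χ ⬝ᵥ χ).re := by
      rw [hHχ, dotProduct_smul, smul_eq_mul, Complex.re_ofReal_mul]
    rw [h2] at h1
    have hpos : 0 < (star χ ⬝ᵥ χ).re := Matrix.star_dotProduct_self_re_pos hχ0
    nlinarith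

end Energies

/-! ### The even torus: two-hole pair binding of the repulsive model in attractive language -/

section Torus

/-- The Shiba gauge on the fermionic torus: phase `1` on up orbitals, the stagger `(-1)^{Σxᵢ}` on
down orbitals; all phases have modulus one. [folklore] -/
theorem norm_shibaTorusPhase {d L : ℕ} (i : Orb (FermionTorus d L)) :
    ‖(fun i : Orb (FermionTorus d L) =>
        if (ofLex i).2 = 1 then (((torusStagger (ofLex i).1 : ℤˣ) : ℤ) : ℂ) else (1 : ℂ)) i‖ = 1 := by
  dsimp only
  split_ifs
  · exact norm_intCast_units _
  · exact norm_one

/-- The Shiba gauge is `1` on up orbitals. [folklore] -/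
theorem shibaTorusPhase_up {d L : ℕ} (x : FermionTorus d L) :
    (fun i : Orb (FermionTorus d L) =>
        if (ofLex i).2 = 1 then (((torusStagger (ofLex i).1 : ℤˣ) : ℤ) : ℂ) else (1 : ℂ)) (orb x 0) = 1 := by
  dsimp only
  rw [if_neg]
  exact Fin.zero_ne_one

/-- On a torus of even side the Shiba gauge is bipartite on the down orbitals:
`g(x↓) g(y↓)* = -1` on every bond. [cite: LiebPRL1989, Theorem 2 (bipartite lattice)] -/
theorem shibaTorusPhase_down_bond {d L : ℕ} (hL : Even L) {x y : FermionTorus d L}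
    (hxy : (fermionTorusGraph d L).Adj x y) :
    (fun i : Orb (FermionTorus d L) =>
        if (ofLex i).2 = 1 then (((torusStagger (ofLex i).1 : ℤˣ) : ℤ) : ℂ) else (1 : ℂ)) (orb x 1) *
      star ((fun i : Orb (FermionTorus d L) =>
        if (ofLex i).2 = 1 then (((torusStagger (ofLex i).1 : ℤˣ) : ℤ) : ℂ) else (1 : ℂ)) (orb y 1)) = -1 := by
  dsimp only
  rw [if_pos (show (ofLex (orb x 1)).2 = 1 from rfl), if_pos (show (ofLex (orb y 1)).2 = 1 from rfl),
    star_intCast_units]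
  exact intCast_units_mul_of_eq_neg (torusStagger_eq_neg_of_adj_holds hL hxy)

/-- **The attraction–repulsion dictionary for the spin-sector energies of the Hubbard torus**
(`(ℤ/Lℤ)^d`, `L` even, any `t`, `U`, `a, b ≤ L^d`):
`E_{t,U}(a, b) = E_{t,-U}(a, L^d - b) + U a`. [cite: Lieb1989, proof of Theorem 2] -/
theorem minEnergyOn_szSector_hubbardTorus_shiba {d L : ℕ} (hL : Even L) (t U : ℝ) {a b : ℕ}
    (ha : a ≤ L ^ d) (hb : b ≤ L ^ d) :
    (hubbardTorus d L t U).minEnergyOn (szSector (a + b) (((a : ℝ) - b) / 2)) =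
      (hubbardTorus d L t (-U)).minEnergyOn
          (szSector (a + (L ^ d - b)) (((a : ℝ) - (L ^ d - b : ℕ)) / 2)) + U * a := by
  have hcard : Fintype.card (FermionTorus d L) = L ^ d := by simp [FermionTorus, Fintype.card_lex]
  have h := minEnergyOn_szSector_shiba (fermionTorusGraph d L)
    (g := fun i : Orb (FermionTorus d L) =>
      if (ofLex i).2 = 1 then (((torusStagger (ofLex i).1 : ℤˣ) : ℤ) : ℂ) else (1 : ℂ))
    norm_shibaTorusPhase shibaTorusPhase_up (fun x y hxy => shibaTorusPhase_down_bond hL hxy) t U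
    (a := a) (b := b) (by rw [hcard]; exact ha) (by rw [hcard]; exact hb)
  rw [hcard] at h
  exact h

/-- Sectors with equal labels are equal (bookkeeping for rewriting `(N, S^z)` labels). [folklore] -/
theorem szSector_congr {Λ : Type*} [LinearOrder Λ] [Fintype Λ] {N N' : ℕ} {M M' : ℝ} (hN : N = N')
    (hM : M = M') : (szSector N M : Submodule ℂ (Fock (Orb Λ))) = szSector N' M' := by
  subst hN; subst hM; rfl

/-- **Two-hole pair binding of the repulsive torus = (charge gap) − (spin gap) data of the
attractive torus at half filling.** On `(ℤ/Lℤ)²` with `L` even, for all `t` and `U`: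
`2E_U(L²-1, ½) - E_U(L², 0) - E_U(L²-2, 0) = 2E_{-U}(L²+1, -½) + U - E_{-U}(L², 0) - E_{-U}(L², -1)`,
where `E_U(N, M) = minEnergyOn (hubbardTorus 2 L t U) (szSector N M)`. The three repulsive sectors
`(N↑,N↓) = (n,n-1), (n,n), (n-1,n-1)` (`2n = L²`) go to the attractive sectors `(n,n+1), (n,n),
(n-1,n+1)` with shifts `Un, Un, U(n-1)`. [cite: Lieb1989, proof of Theorem 2] -/
theorem twoHoleBinding_eq_attractive (L : ℕ) [NeZero L] (hL : Even L) (t U : ℝ) :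
    2 * (hubbardTorus 2 L t U).minEnergyOn (szSector (L ^ 2 - 1) (1 / 2)) -
        (hubbardTorus 2 L t U).minEnergyOn (szSector (L ^ 2) 0) -
        (hubbardTorus 2 L t U).minEnergyOn (szSector (L ^ 2 - 2) 0) =
      2 * (hubbardTorus 2 L t (-U)).minEnergyOn (szSector (L ^ 2 + 1) (-(1 / 2))) + U -
        (hubbardTorus 2 L t (-U)).minEnergyOn (szSector (L ^ 2) 0) -
        (hubbardTorus 2 L t (-U)).minEnergyOn (szSector (L ^ 2) (-1)) := by
  obtain ⟨m, hm⟩ := hL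
  have hL0 : L ≠ 0 := NeZero.ne L
  have hm0 : 1 ≤ m := by omega
  -- `L² = 2n` with `n = 2m²`, `n ≥ 2`
  set n : ℕ := 2 * m ^ 2 with hn
  have hL2 : L ^ 2 = n + n := by rw [hm, hn]; ring
  have hn1 : 1 ≤ n := by have : 1 ≤ m ^ 2 := Nat.one_le_pow 2 m hm0; omega
  -- the three repulsive sectors in `(N↑, N↓)` coordinates
  have e1 : (szSector (L ^ 2 - 1) (1 / 2) : Submodule ℂ (Fock (Orb (FermionTorus 2 L)))) =
      szSector (n + (n - 1)) (((n : ℝ) - (n - 1 : ℕ)) / 2) :=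
    szSector_congr (by omega) (by rw [Nat.cast_sub hn1]; push_cast; ring)
  have e0 : (szSector (L ^ 2) 0 : Submodule ℂ (Fock (Orb (FermionTorus 2 L)))) =
      szSector (n + n) (((n : ℝ) - n) / 2) :=
    szSector_congr (by omega) (by ring)
  have e2 : (szSector (L ^ 2 - 2) 0 : Submodule ℂ (Fock (Orb (FermionTorus 2 L)))) =
      szSector ((n - 1) + (n - 1)) ((((n - 1 : ℕ) : ℝ) - (n - 1 : ℕ)) / 2) :=
    szSector_congr (by omega) (by ring)
  -- and their Shiba images
  have f1 : (szSector (n + (L ^ 2 - (n - 1))) (((n : ℝ) - (L ^ 2 - (n - 1) : ℕ)) / 2) :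
      Submodule ℂ (Fock (Orb (FermionTorus 2 L)))) = szSector (L ^ 2 + 1) (-(1 / 2)) :=
    szSector_congr (by omega) (by
      rw [Nat.cast_sub (by omega : n - 1 ≤ L ^ 2), Nat.cast_sub hn1, Nat.cast_pow, show (L : ℝ) ^ 2 = n + n by
        exact_mod_cast hL2]
      ring)
  have f0 : (szSector (n + (L ^ 2 - n)) (((n : ℝ) - (L ^ 2 - n : ℕ)) / 2) :
      Submodule ℂ (Fock (Orb (FermionTorus 2 L)))) = szSector (L ^ 2) 0 :=
    szSector_congr (by omega) (by
      rw [Nat.cast_sub (by omega : n ≤ L ^ 2), Nat.cast_pow, show (L : ℝ) ^ 2 = n + n by exact_mod_cast hL2]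
      ring)
  have f2 : (szSector ((n - 1) + (L ^ 2 - (n - 1))) ((((n - 1 : ℕ) : ℝ) - (L ^ 2 - (n - 1) : ℕ)) / 2) :
      Submodule ℂ (Fock (Orb (FermionTorus 2 L)))) = szSector (L ^ 2) (-1) :=
    szSector_congr (by omega) (by
      rw [Nat.cast_sub (by omega : n - 1 ≤ L ^ 2), Nat.cast_sub hn1, Nat.cast_pow, show (L : ℝ) ^ 2 = n + n by
        exact_mod_cast hL2]
      ring)
  have hev : Even L := ⟨m, hm⟩
  have d1 := minEnergyOn_szSector_hubbardTorus_shiba (d := 2) hev t U (a := n) (b := n - 1) (by omega) (by omega)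
  have d0 := minEnergyOn_szSector_hubbardTorus_shiba (d := 2) hev t U (a := n) (b := n) (by omega) (by omega)
  have d2 := minEnergyOn_szSector_hubbardTorus_shiba (d := 2) hev t U (a := n - 1) (b := n - 1) (by omega)
    (by omega)
  rw [f1, ← e1] at d1
  rw [f0, ← e0] at d0
  rw [f2, ← e2] at d2
  rw [d1, d0, d2, Nat.cast_sub hn1, Nat.cast_one]
  ring

/-- **The pair-binding clause in attractive language, side by side in `L`.** On `(ℤ/Lℤ)²`, `L`
even: two doped holes bind with margin `ε` in the repulsive torus,
`E_U(L²-2, 0) + E_U(L², 0) + ε ≤ 2E_U(L²-1, ½)`, iff in the ATTRACTIVE torus at half filling the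
lowest `S^z = -1` level lies at least `ε` below the two-quasiparticle threshold,
`E_{-U}(L², -1) + E_{-U}(L², 0) + ε ≤ 2E_{-U}(L²+1, -½) + U`. [cite: Lieb1989, proof of Theorem 2] -/
theorem twoHoleBinding_iff_attractive (L : ℕ) [NeZero L] (hL : Even L) (t U ε : ℝ) :
    (hubbardTorus 2 L t U).minEnergyOn (szSector (L ^ 2 - 2) 0) +
          (hubbardTorus 2 L t U).minEnergyOn (szSector (L ^ 2) 0) + ε ≤
        2 * (hubbardTorus 2 L t U).minEnergyOn (szSector (L ^ 2 - 1) (1 / 2)) ↔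
      (hubbardTorus 2 L t (-U)).minEnergyOn (szSector (L ^ 2) (-1)) +
          (hubbardTorus 2 L t (-U)).minEnergyOn (szSector (L ^ 2) 0) + ε ≤
        2 * (hubbardTorus 2 L t (-U)).minEnergyOn (szSector (L ^ 2 + 1) (-(1 / 2))) + U := by
  have h := twoHoleBinding_eq_attractive L hL t U
  constructor <;> intro h' <;> linarith

/-- **Clause (a) of `PureCooperPair` / the conclusion of `stub_junctionLeg` at the pure point, in
attractive language.** For the pure torus of side `L = 4k + 4` (hopping `1`, repulsion `U`):
uniform two-hole pair binding eventually in `k` is EQUIVALENT to the uniform attractive-model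
inequality `E_{-U}(L², -1) + E_{-U}(L², 0) + ε ≤ 2E_{-U}(L²+1, -½) + U` eventually in `k` — a
statement about the half-filled attractive Hubbard torus (Lieb-unique singlet ground state,
spin-reflection positive), where it reads "spin gap + ε ≤ charge gap". This reformulates the
stub's conclusion; it proves neither direction of the crux. [cite: Lieb1989, proof of Theorem 2] -/
theorem pureBinding_iff_attractive : ∀ (U ε : ℝ) (k₀ : ℕ), (∀ k ≥ k₀, (hubbardTorus 2 (4 * k + 4) 1 U).minEnergyOn (szSector ((4 * k + 4) ^ 2 - 2) 0) + (hubbardTorus 2 (4 * k + 4) 1 U).minEnergyOn (szSector ((4 * k + 4) ^ 2) 0) + ε ≤ 2 * (hubbardTorus 2 (4 * k + 4) 1 U).minEnergyOn (szSector ((4 * k + 4) ^ 2 - 1) (1 / 2))) ↔ ∀ k ≥ k₀, (hubbardTorus 2 (4 * k + 4) 1 (-U)).minEnergyOn (szSector ((4 * k + 4) ^ 2) (-1)) + (hubbardTorus 2 (4 * k + 4) 1 (-U)).minEnergyOn (szSector ((4 * k + 4) ^ 2) 0) + ε ≤ 2 * (hubbardTorus 2 (4 * k + 4) 1 (-U)).minEnergyOn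 (szSector ((4 * k + 4) ^ 2 + 1) (-(1 / 2))) + U := by
  intro U ε k₀
  refine forall₂_congr fun k _ => ?_
  exact twoHoleBinding_iff_attractive (4 * k + 4) ⟨2 * k + 2, by ring⟩ 1 U ε

end Torus

end Summit.HubbardSuperconductivity.HubbardSuperconductivity.Theorems.CooperPairDMottWalk

end
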